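import Literature.Computability.AlgebraicComplexity.TensorOrbitZariskiClosure
import Literature.Computability.AlgebraicComplexity.BI17DegreeExponentMonoidProofs
import Literature.Computability.AlgebraicComplexity.QuantumFunctionalsDegenerationProofs
import HarnessLib

/-!
# Separating closed `SL³`-orbits of tensors by polynomials (GIT, Ch. 1 §2 Cor. 1.2, for `SL_ι(ℂ)³` on `⊗³ℂ^ι`)

Theorem-only companion of `TensorOrbitZariskiClosure.lean` (the `SL³`-orbit of a polystable tensor —
`IsPolystableTensor`, Bürgisser–Ikenmeyer 2017 §4.2, typed with the Euclidean topology in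
`BI17FundamentalInvariantTensors.lean` — is Zariski closed) and of the forms file
`BI17DegreeExponentMonoidProofs.lean` (whose general Nullstellensatz lemma
`exists_mem_vanishingIdeal_add_eq_one_of_disjoint` — "two closed disjoint invariant subsets … are
separated", Mumford–Fogarty–Kirwan, *GIT*, Ch. 1 §2 Cor. 1.2, here only its Nullstellensatz half
`1 ∈ I(Z₁) + I(Z₂)` — is reused, not restated).

Results (all for complex tensors `w : ι → ι → ι → ℂ`, `ι` finite):

* `IsPolystableTensor.smul` — polystability is invariant under scaling the tensor;
* `actTensor_sl3_ne_zero` — `0 ∉ SL³ · w` for `w ≠ 0`; `isPolystableTensor_zero`;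
* `IsPolystableTensor.exists_mem_vanishingIdeal_add_eq_one_of_disjoint` — two DISJOINT closed
  `SL³`-orbits `SL³·w`, `SL³·w'` are separated: `a + b = 1` with `a ∈ I(SL³·w)`, `b ∈ I(SL³·w')`
  (the input of the tensor version of BI 2017 Lemma 6.3 / Thm. 5.3, "the orbit closures of `tw`
  and `w` intersect", once an `SL³`-Reynolds operator splits `a` into invariants);
* `IsPolystableTensor.exists_mem_vanishingIdeal_add_eq_one_zero` and
  `IsPolystableTensor.exists_aeval_eq_zero_and_constantCoeff_eq_one` — a polystable `w ≠ 0` is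
  separated from the origin: some polynomial vanishes on `SL³·w` and takes the value `1` at `0`
  (GIT Ch. 2 §1, proof of Prop. 2.2, the input of Hilbert's nonvanishing "`e(w) > 0`" for tensors,
  cf. the forms proof `exists_pos_mem_degreeMonoid`).

No definitions, no named facts. Honest framing: Nullstellensatz bookkeeping for BI17 §5; nothing
here bears on VP versus VNP.

## References

* [MumfordFogartyKirwan1994] D. Mumford, J. Fogarty, F. Kirwan, *Geometric Invariant Theory*, 3rd
  ed. (Springer 1994), Ch. 1 §2 Cor. 1.2; Ch. 2 §1 Prop. 2.2 (proof).
* [BurgisserIkenmeyer2017] P. Bürgisser, C. Ikenmeyer, *Fundamental invariants of orbit closures*,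
  J. Algebra 477 (2017) 390–434; arXiv:1511.02927, §4.2 (polystable tensors), §6.2 Lemma 6.3.
-/

noncomputable section

open MvPolynomial

namespace Literature.Computability.AlgebraicComplexity

section Separation

variable {ι : Type*} [Fintype ι] [DecidableEq ι]

omit [DecidableEq ι] in
/-- The action is linear in the tensor: `(A ⊗ B ⊗ C)·(c t) = c · (A ⊗ B ⊗ C)·t`. [folklore] -/
private theorem actTensor_smul_tensor (A B C : Matrix ι ι ℂ) (c : ℂ) (t : ι → ι → ι → ℂ) :
    actTensor A B C (c • t) = c • actTensor A B C t := by
  funext x y z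
  simp only [actTensor_apply, Pi.smul_apply, smul_eq_mul, Finset.mul_sum]
  exact Finset.sum_congr rfl fun _ _ => Finset.sum_congr rfl fun _ _ =>
    Finset.sum_congr rfl fun _ _ => by ring

/-- The `SL³`-orbit of `c • w` is `c •` the `SL³`-orbit of `w`. [cite: BurgisserIkenmeyer2017, §6.2 Lemma 6.3 (proof)] -/
theorem range_sl3_actTensor_smul (c : ℂ) (w : ι → ι → ι → ℂ) :
    (Set.range fun g : Matrix.SpecialLinearGroup ι ℂ × Matrix.SpecialLinearGroup ι ℂ ×
        Matrix.SpecialLinearGroup ι ℂ =>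
      actTensor (g.1 : Matrix ι ι ℂ) (g.2.1 : Matrix ι ι ℂ) (g.2.2 : Matrix ι ι ℂ) (c • w)) =
    (fun v => c • v) '' Set.range fun g : Matrix.SpecialLinearGroup ι ℂ ×
        Matrix.SpecialLinearGroup ι ℂ × Matrix.SpecialLinearGroup ι ℂ =>
      actTensor (g.1 : Matrix ι ι ℂ) (g.2.1 : Matrix ι ι ℂ) (g.2.2 : Matrix ι ι ℂ) w := by
  ext v
  simp only [Set.mem_range, Set.mem_image, exists_exists_eq_and, actTensor_smul_tensor]

/-- **Polystability is invariant under scaling the tensor** (`SL³·(c w) = c · SL³·w` is closed with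
`SL³·w`). [cite: BurgisserIkenmeyer2017, §4.2] -/
theorem IsPolystableTensor.smul {w : ι → ι → ι → ℂ} (hw : IsPolystableTensor w) (c : ℂ) :
    IsPolystableTensor (c • w) := by
  unfold IsPolystableTensor at hw ⊢
  rw [range_sl3_actTensor_smul]
  by_cases hc : c = 0
  · subst hc
    have h : (fun v : ι → ι → ι → ℂ => (0 : ℂ) • v) = fun _ => 0 := by
      funext v
      exact zero_smul ℂ v
    rw [h]
    rcases Set.eq_empty_or_nonempty (Set.range fun g : Matrix.SpecialLinearGroup ι ℂ ×
        Matrix.SpecialLinearGroup ι ℂ × Matrix.SpecialLinearGroup ι ℂ =>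
      actTensor (g.1 : Matrix ι ι ℂ) (g.2.1 : Matrix ι ι ℂ) (g.2.2 : Matrix ι ι ℂ) w) with he | hne
    · rw [he, Set.image_empty]
      exact isClosed_empty
    · rw [hne.image_const]
      exact isClosed_singleton
  · exact (Homeomorph.smulOfNeZero c hc).isClosed_image.mpr hw

omit [DecidableEq ι] in
/-- The zero tensor is polystable (its `SL³`-orbit is `{0}`). [cite: BurgisserIkenmeyer2017, §4.2] -/
theorem isPolystableTensor_zero [DecidableEq ι] : IsPolystableTensor (0 : ι → ι → ι → ℂ) := by
  unfold IsPolystableTensor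
  have h : (fun g : Matrix.SpecialLinearGroup ι ℂ × Matrix.SpecialLinearGroup ι ℂ ×
        Matrix.SpecialLinearGroup ι ℂ =>
      actTensor (g.1 : Matrix ι ι ℂ) (g.2.1 : Matrix ι ι ℂ) (g.2.2 : Matrix ι ι ℂ)
        (0 : ι → ι → ι → ℂ)) = fun _ => 0 := by
    funext g
    exact actTensor_zero _ _ _
  rw [h, Set.range_const]
  exact isClosed_singleton

/-- `0 ∉ SL³ · w` for `w ≠ 0` (the action is by invertible maps). [cite: BurgisserIkenmeyer2017, §4.2] -/
theorem actTensor_sl3_ne_zero {w : ι → ι → ι → ℂ} (hw : w ≠ 0)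
    (g : Matrix.SpecialLinearGroup ι ℂ × Matrix.SpecialLinearGroup ι ℂ ×
      Matrix.SpecialLinearGroup ι ℂ) :
    actTensor (g.1 : Matrix ι ι ℂ) (g.2.1 : Matrix ι ι ℂ) (g.2.2 : Matrix ι ι ℂ) w ≠ 0 := by
  intro h0
  apply hw
  have h := congrArg (actTensor ((g.1⁻¹ : Matrix.SpecialLinearGroup ι ℂ) : Matrix ι ι ℂ)
    ((g.2.1⁻¹ : Matrix.SpecialLinearGroup ι ℂ) : Matrix ι ι ℂ)
    ((g.2.2⁻¹ : Matrix.SpecialLinearGroup ι ℂ) : Matrix ι ι ℂ)) h0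
  rw [actTensor_actTensor, actTensor_zero] at h
  simpa only [← Matrix.SpecialLinearGroup.coe_mul, inv_mul_cancel, Matrix.SpecialLinearGroup.coe_one,
    actTensor_one] using h

/-- The `SL³`-orbit of a nonzero tensor does not meet the orbit `{0}` of `0`. [cite: BurgisserIkenmeyer2017, §4.2] -/
theorem disjoint_range_sl3_actTensor_zero {w : ι → ι → ι → ℂ} (hw : w ≠ 0) :
    Disjoint (Set.range fun g : Matrix.SpecialLinearGroup ι ℂ × Matrix.SpecialLinearGroup ι ℂ ×
        Matrix.SpecialLinearGroup ι ℂ =>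
      actTensor (g.1 : Matrix ι ι ℂ) (g.2.1 : Matrix ι ι ℂ) (g.2.2 : Matrix ι ι ℂ) w)
      ({0} : Set (ι → ι → ι → ℂ)) := by
  rw [Set.disjoint_singleton_right]
  rintro ⟨g, hg⟩
  exact actTensor_sl3_ne_zero hw g hg

/-- A closed `SL³`-orbit, read in coordinates, satisfies `Z(I(SL³·w)) ⊆ SL³·w` (it is Zariski closed:
`IsPolystableTensor.zariskiClosure_sl3Orbit_eq`). [cite: LandsbergGCT2017, Thm 3.1.6.1] -/
theorem IsPolystableTensor.zeroLocus_vanishingIdeal_subset {w : ι → ι → ι → ℂ}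
    (hw : IsPolystableTensor w) :
    MvPolynomial.zeroLocus ℂ (MvPolynomial.vanishingIdeal ℂ
      (tensorPt '' Set.range fun g : Matrix.SpecialLinearGroup ι ℂ × Matrix.SpecialLinearGroup ι ℂ ×
          Matrix.SpecialLinearGroup ι ℂ =>
        actTensor (g.1 : Matrix ι ι ℂ) (g.2.1 : Matrix ι ι ℂ) (g.2.2 : Matrix ι ι ℂ) w)) ⊆
      tensorPt '' Set.range fun g : Matrix.SpecialLinearGroup ι ℂ × Matrix.SpecialLinearGroup ι ℂ ×
          Matrix.SpecialLinearGroup ι ℂ =>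
        actTensor (g.1 : Matrix ι ι ℂ) (g.2.1 : Matrix ι ι ℂ) (g.2.2 : Matrix ι ι ℂ) w :=
  hw.zariskiClosure_sl3Orbit_eq.le

/-- **Two disjoint closed `SL³`-orbits are separated by polynomials** (GIT Ch. 1 §2 Cor. 1.2 for
`SL_ι(ℂ)³` on `⊗³ℂ^ι`, Nullstellensatz half): if `w, w'` are polystable with `SL³·w ∩ SL³·w' = ∅`,
there are `a ∈ I(SL³·w)`, `b ∈ I(SL³·w')` with `a + b = 1`.
[cite: MumfordFogartyKirwan1994, Ch. 1 §2 Cor. 1.2] -/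
theorem IsPolystableTensor.exists_mem_vanishingIdeal_add_eq_one_of_disjoint {w w' : ι → ι → ι → ℂ}
    (hw : IsPolystableTensor w) (hw' : IsPolystableTensor w')
    (hdisj : Disjoint
      (Set.range fun g : Matrix.SpecialLinearGroup ι ℂ × Matrix.SpecialLinearGroup ι ℂ ×
          Matrix.SpecialLinearGroup ι ℂ =>
        actTensor (g.1 : Matrix ι ι ℂ) (g.2.1 : Matrix ι ι ℂ) (g.2.2 : Matrix ι ι ℂ) w)
      (Set.range fun g : Matrix.SpecialLinearGroup ι ℂ × Matrix.SpecialLinearGroup ι ℂ ×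
          Matrix.SpecialLinearGroup ι ℂ =>
        actTensor (g.1 : Matrix ι ι ℂ) (g.2.1 : Matrix ι ι ℂ) (g.2.2 : Matrix ι ι ℂ) w')) :
    ∃ a ∈ MvPolynomial.vanishingIdeal ℂ
        (tensorPt '' Set.range fun g : Matrix.SpecialLinearGroup ι ℂ × Matrix.SpecialLinearGroup ι ℂ ×
            Matrix.SpecialLinearGroup ι ℂ =>
          actTensor (g.1 : Matrix ι ι ℂ) (g.2.1 : Matrix ι ι ℂ) (g.2.2 : Matrix ι ι ℂ) w),
      ∃ b ∈ MvPolynomial.vanishingIdeal ℂ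
        (tensorPt '' Set.range fun g : Matrix.SpecialLinearGroup ι ℂ × Matrix.SpecialLinearGroup ι ℂ ×
            Matrix.SpecialLinearGroup ι ℂ =>
          actTensor (g.1 : Matrix ι ι ℂ) (g.2.1 : Matrix ι ι ℂ) (g.2.2 : Matrix ι ι ℂ) w'),
        a + b = 1 :=
  Literature.Computability.AlgebraicComplexity.exists_mem_vanishingIdeal_add_eq_one_of_disjoint
    hw.zeroLocus_vanishingIdeal_subset hw'.zeroLocus_vanishingIdeal_subset
    ((Set.disjoint_image_iff tensorPt_injective).mpr hdisj)

/-- **A polystable nonzero tensor is separated from the origin**: `a + b = 1` with `a ∈ I(SL³·w)` and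
`b ∈ I({0})` (GIT Ch. 2 §1, proof of Prop. 2.2: "`Z_1` = closure of `O(x^*)`, `Z_2 = {(0)}` are
disjoint invariant closed subsets"). [cite: MumfordFogartyKirwan1994, Ch. 2 §1 Prop. 2.2 (proof)] -/
theorem IsPolystableTensor.exists_mem_vanishingIdeal_add_eq_one_zero {w : ι → ι → ι → ℂ}
    (hw : IsPolystableTensor w) (hw0 : w ≠ 0) :
    ∃ a ∈ MvPolynomial.vanishingIdeal ℂ
        (tensorPt '' Set.range fun g : Matrix.SpecialLinearGroup ι ℂ × Matrix.SpecialLinearGroup ι ℂ ×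
            Matrix.SpecialLinearGroup ι ℂ =>
          actTensor (g.1 : Matrix ι ι ℂ) (g.2.1 : Matrix ι ι ℂ) (g.2.2 : Matrix ι ι ℂ) w),
      ∃ b ∈ MvPolynomial.vanishingIdeal ℂ ({0} : Set (ι × ι × ι → ℂ)), a + b = 1 := by
  have h0 : (Set.range fun g : Matrix.SpecialLinearGroup ι ℂ × Matrix.SpecialLinearGroup ι ℂ ×
        Matrix.SpecialLinearGroup ι ℂ =>
      actTensor (g.1 : Matrix ι ι ℂ) (g.2.1 : Matrix ι ι ℂ) (g.2.2 : Matrix ι ι ℂ)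
        (0 : ι → ι → ι → ℂ)) = {0} := by
    have h : (fun g : Matrix.SpecialLinearGroup ι ℂ × Matrix.SpecialLinearGroup ι ℂ ×
          Matrix.SpecialLinearGroup ι ℂ =>
        actTensor (g.1 : Matrix ι ι ℂ) (g.2.1 : Matrix ι ι ℂ) (g.2.2 : Matrix ι ι ℂ)
          (0 : ι → ι → ι → ℂ)) = fun _ => 0 := by
      funext g
      exact actTensor_zero _ _ _
    rw [h, Set.range_const]
  have hpt : tensorPt '' ({0} : Set (ι → ι → ι → ℂ)) = ({0} : Set (ι × ι × ι → ℂ)) := by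
    rw [Set.image_singleton]
    rfl
  have h := hw.exists_mem_vanishingIdeal_add_eq_one_of_disjoint isPolystableTensor_zero
    (by rw [h0]; exact disjoint_range_sl3_actTensor_zero hw0)
  rwa [h0, hpt] at h

/-- The same in evaluation form: for a polystable `w ≠ 0` there is a polynomial in the tensor
coordinates vanishing on `SL³·w` with constant coefficient (value at the origin) `1`.
[cite: MumfordFogartyKirwan1994, Ch. 2 §1 Prop. 2.2 (proof)] -/
theorem IsPolystableTensor.exists_aeval_eq_zero_and_constantCoeff_eq_one {w : ι → ι → ι → ℂ}
    (hw : IsPolystableTensor w) (hw0 : w ≠ 0) :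
    ∃ a : MvPolynomial (ι × ι × ι) ℂ,
      (∀ g : Matrix.SpecialLinearGroup ι ℂ × Matrix.SpecialLinearGroup ι ℂ ×
          Matrix.SpecialLinearGroup ι ℂ,
        aeval (tensorPt (actTensor (g.1 : Matrix ι ι ℂ) (g.2.1 : Matrix ι ι ℂ)
          (g.2.2 : Matrix ι ι ℂ) w)) a = 0) ∧
      constantCoeff a = 1 := by
  obtain ⟨a, ha, b, hb, hab⟩ := hw.exists_mem_vanishingIdeal_add_eq_one_zero hw0
  refine ⟨a, fun g => ?_, ?_⟩
  · exact (MvPolynomial.mem_vanishingIdeal_iff.mp ha) _ ⟨_, ⟨g, rfl⟩, rfl⟩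
  · have hb0 : aeval (0 : ι × ι × ι → ℂ) b = 0 :=
      (MvPolynomial.mem_vanishingIdeal_iff.mp hb) 0 (Set.mem_singleton 0)
    have h1 : aeval (0 : ι × ι × ι → ℂ) (a + b) = 1 := by rw [hab, map_one]
    rw [map_add, hb0, add_zero, MvPolynomial.aeval_zero] at h1
    simpa using h1

end Separation

end Literature.Computability.AlgebraicComplexity

end
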